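import Literature.MathematicalPhysics.QuantumLattice.HubbardEffectiveAction
import HarnessLib

/-!
# The effective action of the seeded 2D Hubbard torus in a counterterm frame

Topic `MathematicalPhysics/QuantumLattice`; definition request `defn-hubbardEffectiveActionCT` (D1′a of
route HubbardSuperconductivity/AposterioriCapRg rev 12; it types the cruxes `CapRgSymmetricCertificateCT`
= stmt-13959 and `SeededBrokenRegimeBoseFermiCT`, and answers refuter finding F1 on stmt-13882: the tree's
`hubbardEffectiveAction` (`HubbardEffectiveAction.lean`) hard-wires the BARE band `ξ = ε_L - μ` into the
free covariance AND into Salmhofer's cutoff `χ₂((ω² + ξ²)/Λ²)`, so that at an interacting chemical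
potential the physical Fermi curve is integrated out without infrared protection).

## The frame (Feldman–Salmhofer–Trubowitz 1996; Benfatto–Giuliani–Mastropietro 2003)

"It is wrong to assume that both the band structure and the Fermi surface stay fixed when the
interaction is turned on … we prefer not to let the Fermi surface move … instead we allow for a change
in the band structure": the bare band `E` is written `E = e + K` with a COUNTERTERM `K`, the Gaussian
measure and the scale decomposition are those of the renormalised band `e`, and `K` — bilinear in the
fermions — is "treated as an extra interaction vertex", the flow starting from `𝒢₀ = λV + 𝒦`,
`𝒦(χ,χ̄) = Σ_α ∫ đp χ̄_α(p) K(p⃗) χ_α(p)` (FST 1996, §1: "the counterterms are chosen such that the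
interacting Fermi surface is held fixed", "Discussion": `E = e + K(e,λ)`; §2 "Flow of Effective
Actions").  For lattice fermions in exactly the normalisation of this tree: BGM 2003, §1.2,
`ε₀(k⃗) = ε(k⃗) + δε(k⃗)`, "the counterterm `δε`, which becomes part of the interaction",
`P(dψ) ∝ exp{-(L²β)⁻¹ Σ_{k,σ} (-ik₀ + ε(k⃗) - μ) ψ̂⁺_{kσ}ψ̂⁻_{kσ}}` ((2.6)), Boltzmann factor
`e^{-𝒱(ψ) - 𝒩(ψ)}` ((2.9)) with `𝒩(ψ) = (L²β)⁻¹ Σ_{k,σ} ν̂(k⃗) ψ̂⁺_{kσ}ψ̂⁻_{kσ}` ((2.10)), `δε = ν̂` on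
the shell, and the symmetry `ε(k⃗) = ε(-k⃗)` ((2.8c); Salmhofer 1998, §2.3: `E(-p) = E(p)`).  Here:

* §1 `TrigPolyC4v` — the FRAMES `K`: real trigonometric polynomials on the Brillouin zone that are
  even and `C₄ᵥ`-invariant, presented by a degree `d` and a real coefficient table `κ_{m,n}`,
  `K(p) = Σ_{m,n ≤ d} κ_{m,n} · ½(cos(m p₁)cos(n p₂) + cos(n p₁)cos(m p₂))` (`TrigPolyC4v.eval`; every
  even `C₄ᵥ`-invariant real trigonometric polynomial is of this form: invariance under the two axis
  reflections leaves the `cos(m p₁)cos(n p₂)`, the diagonal reflection symmetrises in `(m,n)`).  `L`-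
  independent data, read on the torus of side `L` at the lattice momenta `p_k⃗ = 2πk⃗/L`
  (`latticeMomentum`); symmetries `eval_neg/_swap/_reflect/_rot`, periodicity `eval_periodic`,
  evenness on the torus `eval_latticeMomentum_neg`; the coefficient weights `coeffNorm r K =
  Σ (1+m+n)^r |κ_{m,n}|` (`abs_eval_le_coeffNorm`).  `0 : TrigPolyC4v` is the bare frame.
* §2 the RENORMALISED BAND `e_K(k⃗) = ε_L(k⃗) - μ - K(p_k⃗)` (`nambuXiCT`) replacing `ξ = nambuXi L μ`
  everywhere in the seeded Nambu–Gor'kov covariance of `HubbardFreeCovariance.lean` (seed `h φ_d` kept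
  exactly): `nambuDenCT`, `nambuPropagatorCT`, `nambuTwoPointCT`, `hubbardTwoPointCT`,
  `hubbardCovarianceCT`.  Each is LITERALLY the tree's object at the momentum-dependent chemical
  potential `μ + K(p_k⃗)` (`nambuXiCT_eq_nambuXi`, …, `nambuTwoPointCT_eq_nambuTwoPoint`), which
  transports the whole per-momentum API (e.g. `nambuPropagatorCT_zero_seed`: `G₁₁ = 1/(-iω + e_K)`).
* §3 the cutoff ON THE RENORMALISED BAND, `w^K_Λ(k) = χ₂((ω² + e_K²)/Λ²)` (`hubbardCutoffWeightCT`), and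
  the scale decomposition `C^K = C^K_{>Λ} + C^K_{≤Λ}` (`hubbardCovAboveCT/BelowCT/SliceCT`).
* §4 the INTERACTION SLOT `V_K = V + 𝒩_K` (`hubbardInteractionCT`), `V = hubbardInteraction L M β U`
  (BGM 2006 (2.6a)) and the counterterm vertex
  `𝒩_K = counterQuadratic L M β K = Σ_{k,σ} K(p_k⃗) (βL²)⁻¹ ψ̂⁺_{kσ} ψ̂⁻_{kσ}` (BGM 2003 (2.10)) — the
  Grassmann image (`ψ^±_x = (βL²)⁻¹ Σ_k e^{±ikx} ψ̂^±_k`, BGM 2006 (2.5)) of the one-body operator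
  `+Σ_{k⃗,σ} K(p_k⃗) n_{k⃗σ}`, entering `e^{-V_K}` with the sign with which the band enters the free
  weight `exp{-(βL²)⁻¹ Σ (-ik₀ + ξ) ψ̂⁺ψ̂⁻}` (BGM 2006 (2.2), BGM 2003 (2.6)).  SAME MODEL, FRAME MOVED:
  `ξ = e_K + K` (`nambuXi_eq_nambuXiCT_add`), i.e. `H₀(ε_L) - μN = Σ_{k⃗σ} e_K n_{k⃗σ} + Σ_{k⃗σ} K n_{k⃗σ}`,
  so `[Σ e_K n - h(Δ_d + Δ_d†)] + [U Σ n↑n↓ + Σ K n]` is `dWaveSourceTorus L U μ h` term by term.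
* §5 `hubbardEffectiveActionCT L M β U μ h K Λ = effAction ℂ C^K_{>Λ} V_K` and
  `hubbardEffPartitionFnCT = effPartitionFn ℂ C^K_{>Λ} V_K`, with the API of the bare file verbatim:
  antisymmetry (`hubbardCovarianceCT_transpose`, `hubbardCovAboveCT_transpose`), evenness of the weight
  (`hubbardCutoffWeightCT_neg`, uses `K` even), `hubbardCovAboveCT_add_hubbardCovBelowCT`,
  `hubbardCovAboveCT_eq_slice_add`, the semigroup in `Λ` given `Z ≠ 0`
  (`hubbardEffectiveActionCT_semigroup`, `hubbardEffBoltzmannCT_semigroup`), the initial condition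
  (`hubbardEffectiveActionCT_eq_interaction`: weight `≡ 0 ⇒ 𝒢 = V_K`), `0 < Λ ≤ π/β ⇒` everything
  integrated (`hubbardCovAboveCT_eq_of_le`, `hubbardEffectiveActionCT_eq_of_le`),
  `constPart_hubbardEffectiveActionCT`; and the BARE FRAME `K = 0` gives back the tree's objects
  (`nambuXiCT_zero_frame`, `hubbardCovarianceCT_zero_frame`, `hubbardCutoffWeightCT_zero_frame`,
  `hubbardCovAboveCT_zero_frame`, `counterQuadratic_zero`, `hubbardInteractionCT_zero_frame`,
  `hubbardEffectiveActionCT_zero_frame`, `hubbardEffPartitionFnCT_zero_frame`).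

## Sources

J. Feldman, M. Salmhofer, E. Trubowitz, J. Stat. Phys. 84 (1996) 1209, §1 (introduction:
counterterms "bilinear in the fermions … viewed as a modification of `H₀`", "chosen such that the
interacting Fermi surface is held fixed"; "Discussion": `E = e + K(e,λ)`), §2 ("Flow of Effective
Actions": `𝒢₀^I = λV + 𝒦^I`, `𝒦^I(χ,χ̄) = Σ_α∫đp χ̄_α K^I(p⃗) χ_α`) (arXiv:cond-mat/9509006, held text
`paper:arxiv-cond-mat_9509006`, chunks 2, 8, 11, 18–19) [`FeldmanSalmhoferTrubowitz1996`]; FST's `K` is a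
`C^k` function near the Fermi surface — the finitely presented class `TrigPolyC4v` is this request's.
G. Benfatto, A. Giuliani, V. Mastropietro, Ann. Henri Poincaré 4 (2003) 137, §1.2 "The model", eqs. (2.6),
(2.8c), (2.9)–(2.10) of the arXiv version (arXiv:cond-mat/0207210, held text `paper:arxiv-cond-mat_0207210`,
chunks 3–4) [`BenfattoGiulianiMastropietro2003`]; Ann. Henri Poincaré 7 (2006) 809, §1.4 Remarks 5–6 (dynamical
Fermi surface vs. counterterm, "essentially equivalent"), §2.1 (2.2)–(2.6) (arXiv:cond-mat/0507686, held
text chunks 4–6) [`BenfattoGiulianiMastropietro2006`].  M. Salmhofer, Commun. Math. Phys. 194 (1998) 249,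
§2.3 (`E(-p) = E(p)`), §7 Conclusion ("take a Wick ordering covariance which already contains part of the
self-energy … proper renormalization subtractions"; chunk 26 of the held text arXiv:cond-mat/9706188)
[`Salmhofer1998`]; *Renormalization* (1999), (2.105)–(2.106), (4.70)–(4.72), (4.85) [`Salmhofer1999`].

## Design choices and what is NOT claimed

* Finite `(β, L, M)`, purely algebraic over `ℂ`, exactly as `HubbardFreeCovariance` /
  `HubbardEffectiveAction`: no functional-integral identity, no `M → ∞`, no bound on any kernel, no
  statement about the Hubbard model, and NO INVERSION THEOREM (`E = e + K(e,λ)` solved for `e`): the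
  frame `K` is a free parameter, to be EXHIBITED by an a-posteriori certificate together with the
  renormalisation condition it certifies at its own scale.  In particular it is not claimed here that
  `Z · ∫dμ_{C}e^{-V}` and `Z_K · ∫dμ_{C^K}e^{-V_K}` agree (the Gaussian change-of-covariance identity
  behind "same model" lives with the Berezin integral, `GrassmannGaussianMeasureChange.lean`, not with
  `gaussConv`); what is recorded is the literal split `ξ = e_K + K` of the one-body symbol.
* Frames are the symmetrised cosine tables rather than a predicate on functions: no proof obligation
  for the certificate, evenness / `C₄ᵥ` by construction, coefficients and degree accessible
  (`K.coeff m n`, `m, n ≤ K.degree`; entries beyond the degree are ignored).  Real coefficients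
  (rational tables coerce).
* The CT two-point table takes the frame at the Nambu momentum of its FIRST argument, so that
  `hubbardCovarianceCT` is antisymmetric for every `K` with the tree's one-line proof; that this is the
  Nambu–Gor'kov covariance of the quadratic form with band `e_K` uses `e_K(-k⃗) = e_K(k⃗)`
  (`nambuXiCT_neg`), as in the bare file.
* For the sibling request D1′b (certificate functionals): quadratic/quartic kernels of
  `hubbardEffectiveActionCT` are `GrassmannKernels.kernel/weightedKernel` as for the bare action; the
  spatial shell is `{k⃗ : |nambuXiCT L μ K k⃗| ≤ Λ}`; leg weights use `hubbardCutoffWeightCT`.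
* Junk values as in the bare files (`Λ = 0`: weight `χ₂(x/0) = χ₂(0) = 0`; `β = 0`, `L = 0`).
-/

noncomputable section

namespace Literature.MathematicalPhysics.QuantumLattice

open Literature.Probability.LatticeModels GrassmannAlgebra Finset

/-! ### §1 Frames: even, `C₄ᵥ`-invariant real trigonometric polynomials on the Brillouin zone -/

/-- A **counterterm frame**: an even, `C₄ᵥ`-invariant real trigonometric polynomial on the Brillouin
zone `ℝ²/(2πℤ)²`, presented by its degree `d` and the real coefficient table `κ_{m,n}` of the
symmetrised harmonics, `K(p) = Σ_{m,n ≤ d} κ_{m,n} ½(cos(m p₁)cos(n p₂) + cos(n p₁)cos(m p₂))`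
(`TrigPolyC4v.eval`) — a finitely presented, `L`-independent class for the counterterm `K` of
Feldman–Salmhofer–Trubowitz (`E = e + K`, a function of the spatial momentum only; FST allow any `C^k`
function near the Fermi surface, BGM 2003 require `δε(k⃗) = δε(-k⃗)`; here: trigonometric polynomials
with the point symmetry of the square lattice). [cite: FeldmanSalmhoferTrubowitz1996, §1 Discussion (E = e + K)] -/
@[ext]
structure TrigPolyC4v where
  /-- The degree `d`: only harmonics `cos(m p₁)cos(n p₂)` with `m, n ≤ d` are read. -/
  degree : ℕ
  /-- The coefficient `κ_{m,n}` of the symmetrised harmonic `½(cos(m p₁)cos(n p₂) + cos(n p₁)cos(m p₂))`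
  (read for `m, n ≤ degree`; the table need not be symmetric, the harmonic is). -/
  coeff : ℕ → ℕ → ℝ

namespace TrigPolyC4v

/-- The bare frame `K = 0`. [folklore] -/
instance : Zero TrigPolyC4v := ⟨⟨0, fun _ _ => 0⟩⟩

/-- The default frame is the bare one. [folklore] -/
instance : Inhabited TrigPolyC4v := ⟨0⟩

/-- The bare frame has degree `0`. [folklore] -/
@[simp] theorem zero_degree : (0 : TrigPolyC4v).degree = 0 := rfl

/-- The bare frame has zero coefficients. [folklore] -/
@[simp] theorem zero_coeff (m n : ℕ) : (0 : TrigPolyC4v).coeff m n = 0 := rfl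

/-- The **symmetrised `C₄ᵥ` harmonic** `h_{m,n}(p) = ½(cos(m p₁) cos(n p₂) + cos(n p₁) cos(m p₂))`
(`h_{0,0} = 1`, `h_{1,0} = ½(cos p₁ + cos p₂) = -ε/4`, `h_{1,1} = cos p₁ cos p₂`, …). [folklore] -/
def harmonic (m n : ℕ) (p : Fin 2 → ℝ) : ℝ :=
  (Real.cos (m * p 0) * Real.cos (n * p 1) + Real.cos (n * p 0) * Real.cos (m * p 1)) / 2

/-- **Evaluation of a frame** at a (continuous) momentum `p ∈ ℝ²`:
`K(p) = Σ_{m,n ≤ d} κ_{m,n} h_{m,n}(p)`. [folklore] -/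
def eval (K : TrigPolyC4v) (p : Fin 2 → ℝ) : ℝ :=
  ∑ m ∈ range (K.degree + 1), ∑ n ∈ range (K.degree + 1), K.coeff m n * harmonic m n p

/-- The **coefficient weight of order `r`**, `Σ_{m,n ≤ d} (1 + m + n)^r |κ_{m,n}|` (a regularity size of
the frame, uniform in `L`; `r = 0` bounds `sup |K|`, `abs_eval_le_coeffNorm`). [folklore] -/
def coeffNorm (r : ℕ) (K : TrigPolyC4v) : ℝ :=
  ∑ m ∈ range (K.degree + 1), ∑ n ∈ range (K.degree + 1), (1 + m + n : ℝ) ^ r * |K.coeff m n|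

/-- Unfolding `eval`. [folklore] -/
theorem eval_def (K : TrigPolyC4v) (p : Fin 2 → ℝ) : K.eval p =
    ∑ m ∈ range (K.degree + 1), ∑ n ∈ range (K.degree + 1), K.coeff m n * harmonic m n p := rfl

/-- The bare frame is the zero function. [folklore] -/
@[simp] theorem eval_zero (p : Fin 2 → ℝ) : (0 : TrigPolyC4v).eval p = 0 := by
  simp [eval]

/-- `h_{0,0} = 1` (the constant harmonic: a frame can carry a chemical-potential shift). [folklore] -/
@[simp] theorem harmonic_zero_zero (p : Fin 2 → ℝ) : harmonic 0 0 p = 1 := by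
  simp [harmonic]

/-- The harmonics are symmetric in `(m, n)`. [folklore] -/
theorem harmonic_symm (m n : ℕ) (p : Fin 2 → ℝ) : harmonic n m p = harmonic m n p := by
  unfold harmonic; ring

/-- `|h_{m,n}| ≤ 1`. [folklore] -/
theorem abs_harmonic_le_one (m n : ℕ) (p : Fin 2 → ℝ) : |harmonic m n p| ≤ 1 := by
  have h1 : |Real.cos (m * p 0) * Real.cos (n * p 1)| ≤ 1 := by
    rw [abs_mul]
    exact mul_le_one₀ (Real.abs_cos_le_one _) (abs_nonneg _) (Real.abs_cos_le_one _)
  have h2 : |Real.cos (n * p 0) * Real.cos (m * p 1)| ≤ 1 := by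
    rw [abs_mul]
    exact mul_le_one₀ (Real.abs_cos_le_one _) (abs_nonneg _) (Real.abs_cos_le_one _)
  rw [harmonic, abs_div, abs_two, div_le_one (by norm_num : (0 : ℝ) < 2)]
  exact (abs_add_le _ _).trans (by linarith)

/-- `cos(m(x + 2πz)) = cos(mx)` for natural `m` and integer `z`. [folklore] -/
theorem cos_nat_mul_add_int_mul_two_pi (m : ℕ) (x : ℝ) (z : ℤ) :
    Real.cos (m * (x + z * (2 * Real.pi))) = Real.cos (m * x) := by
  have : (m : ℝ) * (x + z * (2 * Real.pi)) = m * x + ((m * z : ℤ) : ℝ) * (2 * Real.pi) := by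
    push_cast; ring
  rw [this, Real.cos_add_int_mul_two_pi]

/-- The harmonics are even: `h(-p) = h(p)`. [folklore] -/
theorem harmonic_neg (m n : ℕ) (p : Fin 2 → ℝ) : harmonic m n (-p) = harmonic m n p := by
  simp [harmonic, mul_neg, Real.cos_neg]

/-- The harmonics are invariant under the diagonal reflection `(p₁,p₂) ↦ (p₂,p₁)`. [folklore] -/
theorem harmonic_swap (m n : ℕ) (p : Fin 2 → ℝ) : harmonic m n ![p 1, p 0] = harmonic m n p := by
  simp [harmonic]; ring

/-- The harmonics are invariant under the axis reflection `(p₁,p₂) ↦ (p₁,-p₂)`. [folklore] -/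
theorem harmonic_reflect (m n : ℕ) (p : Fin 2 → ℝ) : harmonic m n ![p 0, -p 1] = harmonic m n p := by
  simp [harmonic, mul_neg, Real.cos_neg]

/-- The harmonics are invariant under the rotation by `π/2`, `(p₁,p₂) ↦ (-p₂,p₁)`; with
`harmonic_reflect` this is invariance under the whole point group `C₄ᵥ` of the square lattice. [folklore] -/
theorem harmonic_rot (m n : ℕ) (p : Fin 2 → ℝ) : harmonic m n ![-p 1, p 0] = harmonic m n p := by
  simp [harmonic, mul_neg, Real.cos_neg]; ring

/-- The harmonics are `(2πℤ)²`-periodic: functions on the Brillouin zone. [folklore] -/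
theorem harmonic_periodic (m n : ℕ) (p : Fin 2 → ℝ) (z : Fin 2 → ℤ) :
    harmonic m n (fun i => p i + z i * (2 * Real.pi)) = harmonic m n p := by
  simp only [harmonic, cos_nat_mul_add_int_mul_two_pi]

/-- **Frames are even**: `K(-p) = K(p)` (FST 1996 / Salmhofer 1998 §2.3: `E(-p) = E(p)`;
BGM 2003 (2.8c)). [folklore] -/
theorem eval_neg (K : TrigPolyC4v) (p : Fin 2 → ℝ) : K.eval (-p) = K.eval p := by
  simp only [eval, harmonic_neg]

/-- Frames are invariant under the diagonal reflection. [folklore] -/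
theorem eval_swap (K : TrigPolyC4v) (p : Fin 2 → ℝ) : K.eval ![p 1, p 0] = K.eval p := by
  simp only [eval, harmonic_swap]

/-- Frames are invariant under the axis reflection. [folklore] -/
theorem eval_reflect (K : TrigPolyC4v) (p : Fin 2 → ℝ) : K.eval ![p 0, -p 1] = K.eval p := by
  simp only [eval, harmonic_reflect]

/-- **Frames are `C₄ᵥ`-invariant**: invariance under the rotation by `π/2` (and `eval_reflect`). [folklore] -/
theorem eval_rot (K : TrigPolyC4v) (p : Fin 2 → ℝ) : K.eval ![-p 1, p 0] = K.eval p := by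
  simp only [eval, harmonic_rot]

/-- Frames are `(2πℤ)²`-periodic. [folklore] -/
theorem eval_periodic (K : TrigPolyC4v) (p : Fin 2 → ℝ) (z : Fin 2 → ℤ) :
    K.eval (fun i => p i + z i * (2 * Real.pi)) = K.eval p := by
  simp only [eval, harmonic_periodic]

/-- `cos(m p_i(-k⃗)) = cos(m p_i(k⃗))` at lattice momenta `p(k⃗) = 2πk⃗/L` (`(-k)_i` is `0` or `L - k_i`).
[folklore] -/
theorem cos_nat_mul_latticeMomentum_neg {d L : ℕ} [NeZero L] (m : ℕ) (k : TorusSite d L) (i : Fin d) :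
    Real.cos (m * latticeMomentum L (-k) i) = Real.cos (m * latticeMomentum L k i) := by
  simp only [latticeMomentum, Pi.neg_apply, ZMod.neg_val]
  split_ifs with h
  · rw [h, ZMod.val_zero]
  · have hL : (L : ℝ) ≠ 0 := by exact_mod_cast NeZero.ne L
    rw [Nat.cast_sub (ZMod.val_lt _).le,
      show (m : ℝ) * (2 * Real.pi * ((L : ℝ) - ((k i).val : ℕ)) / L) =
          -(m * (2 * Real.pi * (((k i).val : ℕ) : ℝ) / L)) + (m : ℕ) * (2 * Real.pi) by
        field_simp; ring,
      Real.cos_add_nat_mul_two_pi, Real.cos_neg]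

/-- The harmonics are even on the dual torus: `h(p(-k⃗)) = h(p(k⃗))`. [folklore] -/
theorem harmonic_latticeMomentum_neg {L : ℕ} [NeZero L] (m n : ℕ) (k : TorusSite 2 L) :
    harmonic m n (latticeMomentum L (-k)) = harmonic m n (latticeMomentum L k) := by
  simp only [harmonic, cos_nat_mul_latticeMomentum_neg]

/-- **Frames are even on the dual torus**: `K(p(-k⃗)) = K(p(k⃗))`, `k⃗ ∈ (ℤ/Lℤ)²` — the form in which
evenness is consumed by the Nambu pairing `(k, -k)` and by the cutoff weights. [folklore] -/
theorem eval_latticeMomentum_neg {L : ℕ} [NeZero L] (K : TrigPolyC4v) (k : TorusSite 2 L) :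
    K.eval (latticeMomentum L (-k)) = K.eval (latticeMomentum L k) := by
  simp only [eval, harmonic_latticeMomentum_neg]

/-- The coefficient weights are nonnegative. [folklore] -/
theorem coeffNorm_nonneg (r : ℕ) (K : TrigPolyC4v) : 0 ≤ K.coeffNorm r :=
  sum_nonneg fun _ _ => sum_nonneg fun _ _ => mul_nonneg (by positivity) (abs_nonneg _)

/-- `sup_p |K(p)| ≤ Σ |κ_{m,n}| = coeffNorm 0 K`. [folklore] -/
theorem abs_eval_le_coeffNorm (K : TrigPolyC4v) (p : Fin 2 → ℝ) : |K.eval p| ≤ K.coeffNorm 0 := by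
  rw [eval, coeffNorm]
  refine (abs_sum_le_sum_abs _ _).trans (sum_le_sum fun m _ => (abs_sum_le_sum_abs _ _).trans
    (sum_le_sum fun n _ => ?_))
  rw [abs_mul, pow_zero, one_mul]
  exact mul_le_of_le_one_right (abs_nonneg _) (abs_harmonic_le_one m n p)

end TrigPolyC4v

/-! ### §2 The renormalised band and the counterterm-frame covariance -/

section Frame

variable (L : ℕ) (M : ℕ)

/-- The **renormalised band** `e_K(k⃗) = ε_L(k⃗) - μ - K(p_k⃗)` of the frame `K` (FST 1996: `e = E - K`;
BGM 2003 §1.1–1.2: `ε₀ = ε + δε`), replacing the bare `ξ = ε_L - μ` (`nambuXi`). [cite: BenfattoGiulianiMastropietro2003, §1.1 (ε₀ = ε + δε)] -/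
def nambuXiCT (μ : ℝ) (K : TrigPolyC4v) (k : TorusSite 2 L) : ℝ :=
  torusBand L k - μ - K.eval (latticeMomentum L k)

/-- `e_K` is the bare band at the momentum-dependent chemical potential `μ + K(p_k⃗)`. [folklore] -/
theorem nambuXiCT_eq_nambuXi (μ : ℝ) (K : TrigPolyC4v) (k : TorusSite 2 L) :
    nambuXiCT L μ K k = nambuXi L (μ + K.eval (latticeMomentum L k)) k := by
  rw [nambuXiCT, nambuXi, sub_sub]

/-- **Same model, frame moved**: `ξ = e_K + K` — the one-body symbol of `H₀ - μN` splits into the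
renormalised band and the counterterm (FST 1996 §1, `E = e + K`). [folklore] -/
theorem nambuXi_eq_nambuXiCT_add (μ : ℝ) (K : TrigPolyC4v) (k : TorusSite 2 L) :
    nambuXi L μ k = nambuXiCT L μ K k + K.eval (latticeMomentum L k) := by
  rw [nambuXiCT, nambuXi, sub_add_cancel]

/-- In the bare frame `e_0 = ξ`. [folklore] -/
@[simp] theorem nambuXiCT_zero_frame (μ : ℝ) (k : TorusSite 2 L) : nambuXiCT L μ 0 k = nambuXi L μ k := by
  rw [nambuXiCT, TrigPolyC4v.eval_zero, sub_zero, nambuXi]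

/-- The renormalised band is even, `e_K(-k⃗) = e_K(k⃗)` (band and frame are). [folklore] -/
theorem nambuXiCT_neg [NeZero L] (μ : ℝ) (K : TrigPolyC4v) (k : TorusSite 2 L) :
    nambuXiCT L μ K (-k) = nambuXiCT L μ K k := by
  rw [nambuXiCT, nambuXiCT, torusBand_neg L, TrigPolyC4v.eval_latticeMomentum_neg]

/-- The BCS denominator in the frame `K`: `ω² + e_K(k⃗)² + (hφ_d(k⃗))²`. [folklore] -/
def nambuDenCT (β μ h : ℝ) (K : TrigPolyC4v) (k : FreqMomentum L M) : ℝ :=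
  matsubaraFreq β M k.1 ^ 2 + nambuXiCT L μ K k.2 ^ 2 + (h * dWaveSymbol L k.2) ^ 2

/-- The **Nambu propagator in the frame `K`**: `(-iω + M_K(k⃗))⁻¹`, `M_K = [[e_K, hφ_d],[hφ_d, -e_K]]`,
entrywise `[[iω + e_K, hφ_d],[hφ_d, iω - e_K]]/(ω² + e_K² + h²φ_d²)` — `nambuPropagator` with `ξ ↦ e_K`.
[folklore] -/
def nambuPropagatorCT (β μ h : ℝ) (K : TrigPolyC4v) (k : FreqMomentum L M) : Matrix (Fin 2) (Fin 2) ℂ :=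
  !![(Complex.I * matsubaraFreq β M k.1 + nambuXiCT L μ K k.2) / nambuDenCT L M β μ h K k,
      (h * dWaveSymbol L k.2 : ℝ) / nambuDenCT L M β μ h K k;
    (h * dWaveSymbol L k.2 : ℝ) / nambuDenCT L M β μ h K k,
      (Complex.I * matsubaraFreq β M k.1 - nambuXiCT L μ K k.2) / nambuDenCT L M β μ h K k]

variable (β μ h : ℝ) (K : TrigPolyC4v)

/-- The CT denominator is the bare one at chemical potential `μ + K(p_k⃗)`. [folklore] -/
theorem nambuDenCT_eq_nambuDen (k : FreqMomentum L M) :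
    nambuDenCT L M β μ h K k = nambuDen L M β (μ + K.eval (latticeMomentum L k.2)) h k := by
  rw [nambuDenCT, nambuDen, nambuXiCT_eq_nambuXi]

/-- The CT propagator is the bare one at chemical potential `μ + K(p_k⃗)`. [folklore] -/
theorem nambuPropagatorCT_eq_nambuPropagator (k : FreqMomentum L M) :
    nambuPropagatorCT L M β μ h K k = nambuPropagator L M β (μ + K.eval (latticeMomentum L k.2)) h k := by
  rw [nambuPropagatorCT, nambuPropagator, nambuDenCT_eq_nambuDen, nambuXiCT_eq_nambuXi]

/-- In the bare frame the CT propagator is `nambuPropagator`. [folklore] -/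
theorem nambuPropagatorCT_zero_frame (k : FreqMomentum L M) :
    nambuPropagatorCT L M β μ h 0 k = nambuPropagator L M β μ h k := by
  rw [nambuPropagatorCT_eq_nambuPropagator, TrigPolyC4v.eval_zero, add_zero]

/-- **Without seed the CT propagator is the free propagator of the renormalised band**:
`G₁₁(k) = 1/(-iω + e_K(k⃗))` at `h = 0` (`β ≠ 0`; BGM 2003 (2.6): the measure with `-ik₀ + ε(k⃗) - μ`).
[cite: BenfattoGiulianiMastropietro2003, §1.2 The model (2.6)] -/
theorem nambuPropagatorCT_zero_seed {β : ℝ} (hβ : β ≠ 0) (μ : ℝ) (K : TrigPolyC4v) (k : FreqMomentum L M) :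
    nambuPropagatorCT L M β μ 0 K k 0 0 = 1 / (-Complex.I * matsubaraFreq β M k.1 + nambuXiCT L μ K k.2) := by
  rw [nambuPropagatorCT_eq_nambuPropagator, nambuPropagator_zero_seed L M hβ, nambuXiCT_eq_nambuXi]

end Frame

section Covariance

variable (L M : ℕ)

/-- The ordered free two-point table in Nambu labels in the frame `K`:
`⟨Ψ̂⁻_{k,a} Ψ̂⁺_{k',b}⟩ = βL² δ_{kk'} G_K(k)_{ab}`, `0` otherwise (`nambuTwoPoint` with `ξ ↦ e_K`; the frame
is read at the Nambu momentum of the first argument). [folklore] -/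
def nambuTwoPointCT (β μ h : ℝ) (K : TrigPolyC4v) (X Y : (FreqMomentum L M × Fin 2) × Fin 2) : ℂ :=
  if X.2 = 1 ∧ Y.2 = 0 ∧ X.1.1 = Y.1.1 then
    ((β * (L : ℝ) ^ 2 : ℝ) : ℂ) * nambuPropagatorCT L M β μ h K X.1.1 X.1.2 Y.1.2
  else 0

/-- The CT Nambu table is the bare one at chemical potential `μ + K(p)`, `p` the momentum of the first
label. [folklore] -/
theorem nambuTwoPointCT_eq_nambuTwoPoint (β μ h : ℝ) (K : TrigPolyC4v) (X Y : (FreqMomentum L M × Fin 2) × Fin 2) :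
    nambuTwoPointCT L M β μ h K X Y = nambuTwoPoint L M β (μ + K.eval (latticeMomentum L X.1.1.2)) h X Y := by
  rw [nambuTwoPointCT, nambuTwoPoint, nambuPropagatorCT_eq_nambuPropagator]

/-- The **free two-point table in the frame `K`**, `⟨ψ_X ψ_Y⟩₀^K`: the CT Nambu table transported along
`toNambu` and antisymmetrised (`hubbardTwoPoint` with `ξ ↦ e_K`). [folklore] -/
def hubbardTwoPointCT (β μ h : ℝ) (K : TrigPolyC4v) (X Y : HubbardFieldIdx L M) : ℂ :=
  nambuTwoPointCT L M β μ h K (toNambu X) (toNambu Y) - nambuTwoPointCT L M β μ h K (toNambu Y) (toNambu X)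

/-- **The free covariance in the frame `K`**: `C^K(X,Y) = -⟨ψ_X ψ_Y⟩₀^K`, the covariance of the seeded
quadratic form with the RENORMALISED band `e_K` in place of `ξ` (BGM 2003 (2.6): the Gaussian measure of
the counterterm scheme carries `-ik₀ + ε(k⃗) - μ`, `ε = ε₀ - δε`), in the convention of
`hubbardCovariance` / `gaussConv_gen_mul_gen`. [cite: BenfattoGiulianiMastropietro2003, §1.2 The model (2.6)] -/
def hubbardCovarianceCT (β μ h : ℝ) (K : TrigPolyC4v) : Matrix (HubbardFieldIdx L M) (HubbardFieldIdx L M) ℂ :=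
  Matrix.of fun X Y => -hubbardTwoPointCT L M β μ h K X Y

variable (β μ h : ℝ) (K : TrigPolyC4v)

/-- The CT two-point table is antisymmetric (for every frame). [folklore] -/
theorem hubbardTwoPointCT_swap (X Y : HubbardFieldIdx L M) :
    hubbardTwoPointCT L M β μ h K Y X = -hubbardTwoPointCT L M β μ h K X Y := by
  simp only [hubbardTwoPointCT]; ring

/-- **The CT covariance is antisymmetric**, `(C^K)ᵀ = -C^K`. [folklore] -/
theorem hubbardCovarianceCT_transpose :
    (hubbardCovarianceCT L M β μ h K).transpose = -hubbardCovarianceCT L M β μ h K := by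
  ext X Y
  simp only [hubbardCovarianceCT, Matrix.transpose_apply, Matrix.of_apply, Matrix.neg_apply,
    hubbardTwoPointCT_swap L M β μ h K X Y, neg_neg]

/-- **Bare frame**: `C^0 = C`, the tree's `hubbardCovariance`. [folklore] -/
theorem hubbardCovarianceCT_zero_frame : hubbardCovarianceCT L M β μ h 0 = hubbardCovariance L M β μ h := by
  ext X Y
  simp only [hubbardCovarianceCT, hubbardCovariance, Matrix.of_apply, hubbardTwoPointCT, hubbardTwoPoint,
    nambuTwoPointCT_eq_nambuTwoPoint, TrigPolyC4v.eval_zero, add_zero]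

/-- The Gaussian two-point function of `dμ_{C^K}` is the CT two-point table:
`∫ dμ_{C^K} ψ_X ψ_Y = ⟨ψ_X ψ_Y⟩₀^K`. [folklore] -/
theorem gaussExpect_hubbardCovarianceCT_gen_mul_gen [NeZero L] (X Y : HubbardFieldIdx L M) :
    gaussExpect ℂ (hubbardCovarianceCT L M β μ h K) (gen ℂ X * gen ℂ Y) = hubbardTwoPointCT L M β μ h K X Y := by
  rw [gaussExpect_gen_mul_gen, hubbardCovarianceCT, Matrix.of_apply, Matrix.of_apply,
    hubbardTwoPointCT_swap L M β μ h K X Y]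
  simp only [one_div, neg_neg, sub_neg_eq_add, ← two_mul, ← mul_assoc]
  rw [show ((2⁻¹ : ℚ) • (1 : ℂ)) * 2 = 1 by norm_num, one_mul]

/-- **BGM's normalisation in the frame `K`**: `∫ dμ_{C^K} ψ̂⁻_{k↑} ψ̂⁺_{k'↑} = βL² δ_{kk'} G_K(k)₁₁`
(BGM 2003 (2.6) / BGM 2006 (2.3) with the renormalised band). [folklore] -/
theorem hubbardTwoPointCT_psiMinus_psiPlus [NeZero L] (k k' : FreqMomentum L M) :
    gaussExpect ℂ (hubbardCovarianceCT L M β μ h K) (psiMinus k 0 * psiPlus k' 0) =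
      if k = k' then ((β * (L : ℝ) ^ 2 : ℝ) : ℂ) * nambuPropagatorCT L M β μ h K k 0 0 else 0 := by
  rw [psiMinus, psiPlus, gaussExpect_hubbardCovarianceCT_gen_mul_gen, hubbardTwoPointCT]
  simp [toNambu, nambuTwoPointCT]

end Covariance

/-! ### §3 The cutoff on the renormalised band and the CT scale decomposition -/

section Cutoff

variable (L M : ℕ)

/-- The **weight of the fields above scale `Λ` in the frame `K`**: `χ₂((ω² + e_K(k⃗)²)/Λ²)` — Salmhofer's
cutoff (`salmhoferCutoff`, (4.70) with `ε_t = Λ`) comparing `|iω - e_K|²`, NOT `|iω - ξ|²`, with `Λ²`: the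
scales are shells around the renormalised Fermi curve `{e_K = 0}` (FST 1996 §1 "Results": the shell of
scale `j` is `M^{j-2} ≤ |ip₀ - e(p⃗)| ≤ M^j` for the renormalised `e`). [cite: Salmhofer1999, §4.2.5 (4.70)] -/
def hubbardCutoffWeightCT (β μ : ℝ) (K : TrigPolyC4v) (Λ : ℝ) (k : FreqMomentum L M) : ℝ :=
  salmhoferCutoff ((matsubaraFreq β M k.1 ^ 2 + nambuXiCT L μ K k.2 ^ 2) / Λ ^ 2)

/-- The CT weight is the bare weight at chemical potential `μ + K(p_k⃗)`. [folklore] -/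
theorem hubbardCutoffWeightCT_eq_hubbardCutoffWeight (β μ : ℝ) (K : TrigPolyC4v) (Λ : ℝ) (k : FreqMomentum L M) :
    hubbardCutoffWeightCT L M β μ K Λ k = hubbardCutoffWeight L M β (μ + K.eval (latticeMomentum L k.2)) Λ k := by
  rw [hubbardCutoffWeightCT, hubbardCutoffWeight, nambuXiCT_eq_nambuXi]

/-- Bare frame: the CT weight is `hubbardCutoffWeight`. [folklore] -/
@[simp] theorem hubbardCutoffWeightCT_zero_frame (β μ Λ : ℝ) (k : FreqMomentum L M) :
    hubbardCutoffWeightCT L M β μ 0 Λ k = hubbardCutoffWeight L M β μ Λ k := by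
  rw [hubbardCutoffWeightCT, nambuXiCT_zero_frame, hubbardCutoffWeight]

/-- **The CT weight is even in `k`** (`ω ↦ -ω`, `e_K` even because band AND frame are): the fields `±k`
paired by the seed carry the same weight. [folklore] -/
theorem hubbardCutoffWeightCT_neg [NeZero L] (β μ : ℝ) (K : TrigPolyC4v) (Λ : ℝ) (k : FreqMomentum L M) :
    hubbardCutoffWeightCT L M β μ K Λ k.neg = hubbardCutoffWeightCT L M β μ K Λ k := by
  simp only [hubbardCutoffWeightCT, FreqMomentum.neg, matsubaraFreq_rev, neg_sq, nambuXiCT_neg]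

/-- The **CT covariance above scale `Λ`**, `C^K_{>Λ}(X,Y) = ½(w^K_Λ(k_X) + w^K_Λ(k_Y)) C^K(X,Y)`
(symmetrised weight, as `hubbardCovAbove`). [cite: Salmhofer1999, §4.2.5 (4.70)] -/
def hubbardCovAboveCT (β μ h : ℝ) (K : TrigPolyC4v) (Λ : ℝ) :
    Matrix (HubbardFieldIdx L M) (HubbardFieldIdx L M) ℂ :=
  Matrix.of fun X Y =>
    (((hubbardCutoffWeightCT L M β μ K Λ (momentumOf L M X) +
        hubbardCutoffWeightCT L M β μ K Λ (momentumOf L M Y)) / 2 : ℝ) : ℂ) *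
      hubbardCovarianceCT L M β μ h K X Y

/-- The **CT covariance at and below scale `Λ`**, `C^K_{≤Λ} = C^K - C^K_{>Λ}`. [folklore] -/
def hubbardCovBelowCT (β μ h : ℝ) (K : TrigPolyC4v) (Λ : ℝ) :
    Matrix (HubbardFieldIdx L M) (HubbardFieldIdx L M) ℂ :=
  hubbardCovarianceCT L M β μ h K - hubbardCovAboveCT L M β μ h K Λ

/-- The **CT slice covariance** `C^K_{(Λ,Λ']} = C^K_{>Λ} - C^K_{>Λ'}`. [folklore] -/
def hubbardCovSliceCT (β μ h : ℝ) (K : TrigPolyC4v) (Λ Λ' : ℝ) :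
    Matrix (HubbardFieldIdx L M) (HubbardFieldIdx L M) ℂ :=
  hubbardCovAboveCT L M β μ h K Λ - hubbardCovAboveCT L M β μ h K Λ'

variable (β μ h : ℝ) (K : TrigPolyC4v)

/-- `C^K_{>Λ}` is antisymmetric. [folklore] -/
theorem hubbardCovAboveCT_transpose (Λ : ℝ) :
    (hubbardCovAboveCT L M β μ h K Λ).transpose = -hubbardCovAboveCT L M β μ h K Λ := by
  ext X Y
  have hC := congrFun (congrFun (hubbardCovarianceCT_transpose L M β μ h K) X) Y
  rw [Matrix.transpose_apply, Matrix.neg_apply] at hC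
  simp only [hubbardCovAboveCT, Matrix.transpose_apply, Matrix.of_apply, Matrix.neg_apply, hC, mul_neg,
    add_comm (hubbardCutoffWeightCT L M β μ K Λ (momentumOf L M Y))]

/-- **CT scale decomposition** `C^K = C^K_{>Λ} + C^K_{≤Λ}`. [folklore] -/
theorem hubbardCovAboveCT_add_hubbardCovBelowCT (Λ : ℝ) :
    hubbardCovAboveCT L M β μ h K Λ + hubbardCovBelowCT L M β μ h K Λ = hubbardCovarianceCT L M β μ h K :=
  add_sub_cancel _ _

/-- `C^K_{>Λ} = C^K_{(Λ,Λ']} + C^K_{>Λ'}`: lowering the infrared scale adds a slice. [folklore] -/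
theorem hubbardCovAboveCT_eq_slice_add (Λ Λ' : ℝ) :
    hubbardCovAboveCT L M β μ h K Λ = hubbardCovSliceCT L M β μ h K Λ Λ' + hubbardCovAboveCT L M β μ h K Λ' :=
  (sub_add_cancel _ _).symm

/-- Bare frame: `C^0_{>Λ} = C_{>Λ}`, the tree's `hubbardCovAbove`. [folklore] -/
theorem hubbardCovAboveCT_zero_frame (Λ : ℝ) : hubbardCovAboveCT L M β μ h 0 Λ = hubbardCovAbove L M β μ h Λ := by
  ext X Y
  simp only [hubbardCovAboveCT, hubbardCovAbove, Matrix.of_apply, hubbardCutoffWeightCT_zero_frame,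
    hubbardCovarianceCT_zero_frame]

/-- Bare frame: `C^0_{≤Λ} = C_{≤Λ}`. [folklore] -/
theorem hubbardCovBelowCT_zero_frame (Λ : ℝ) : hubbardCovBelowCT L M β μ h 0 Λ = hubbardCovBelow L M β μ h Λ := by
  rw [hubbardCovBelowCT, hubbardCovBelow, hubbardCovAboveCT_zero_frame, hubbardCovarianceCT_zero_frame]

/-- Bare frame: `C^0_{(Λ,Λ']} = C_{(Λ,Λ']}`. [folklore] -/
theorem hubbardCovSliceCT_zero_frame (Λ Λ' : ℝ) :
    hubbardCovSliceCT L M β μ h 0 Λ Λ' = hubbardCovSlice L M β μ h Λ Λ' := by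
  rw [hubbardCovSliceCT, hubbardCovSlice, hubbardCovAboveCT_zero_frame, hubbardCovAboveCT_zero_frame]

/-- **Temperature is an infrared cutoff** in every frame: for `0 < Λ ≤ π/β` every field is above scale,
`C^K_{>Λ} = C^K`. [folklore] -/
theorem hubbardCovAboveCT_eq_of_le {β Λ : ℝ} (hβ : 0 < β) (hΛ : 0 < Λ) (hle : Λ ≤ Real.pi / β) (μ h : ℝ)
    (K : TrigPolyC4v) : hubbardCovAboveCT L M β μ h K Λ = hubbardCovarianceCT L M β μ h K := by
  have hw : ∀ k : FreqMomentum L M, hubbardCutoffWeightCT L M β μ K Λ k = 1 := by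
    intro k
    rw [hubbardCutoffWeightCT, salmhoferCutoff_of_ge]
    rw [le_div_iff₀ (by positivity), one_mul]
    have h1 : Λ ≤ |matsubaraFreq β M k.1| := hle.trans (pi_div_le_abs_matsubaraFreq hβ _)
    have h2 : Λ ^ 2 ≤ matsubaraFreq β M k.1 ^ 2 := by
      rw [← sq_abs (matsubaraFreq _ _ _)]
      exact pow_le_pow_left₀ hΛ.le h1 2
    nlinarith [sq_nonneg (nambuXiCT L μ K k.2)]
  ext X Y
  rw [hubbardCovAboveCT, Matrix.of_apply, hw, hw]
  norm_num

/-- If no field is above scale (`w^K_Λ ≡ 0`), then `C^K_{>Λ} = 0`. [folklore] -/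
theorem hubbardCovAboveCT_eq_zero_of_weight {β μ Λ : ℝ} {K : TrigPolyC4v}
    (hw : ∀ k, hubbardCutoffWeightCT L M β μ K Λ k = 0) (h : ℝ) : hubbardCovAboveCT L M β μ h K Λ = 0 := by
  ext X Y
  rw [hubbardCovAboveCT, Matrix.of_apply, hw, hw, Matrix.zero_apply]
  norm_num

end Cutoff

/-! ### §4 The interaction slot: Hubbard vertex plus the quadratic counterterm -/

section Interaction

variable (L M : ℕ) [NeZero L]

/-- The **quadratic counterterm vertex** of the frame `K`,
`𝒩_K = Σ_{k,σ} K(p_k⃗) (βL²)⁻¹ ψ̂⁺_{kσ} ψ̂⁻_{kσ}` (BGM 2003, (2.10): `𝒩(ψ) = (L²β)⁻¹ Σ_{k,σ} ν̂(k⃗) ψ̂⁺ψ̂⁻`,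
in the Boltzmann factor `e^{-𝒱-𝒩}` of (2.9); FST 1996 §2: `𝒦(χ,χ̄) = Σ_α∫đp χ̄_α K(p⃗) χ_α`): the
Grassmann image, via `ψ^±_x = (βL²)⁻¹Σ_k e^{±ikx}ψ̂^±_k` (BGM 2006 (2.5); one factor `(βL²)⁻¹` survives
`∫dx`), of the one-body operator `+Σ_{k⃗σ} K(p_k⃗) n_{k⃗σ}`, with the sign with which the band enters the
free weight `exp{-(βL²)⁻¹Σ(-ik₀ + ξ)ψ̂⁺ψ̂⁻}` (BGM 2006 (2.2)). [cite: BenfattoGiulianiMastropietro2003, §1.2 The model (2.10)] -/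
def counterQuadratic (β : ℝ) (K : TrigPolyC4v) : HubbardGrassmann L M :=
  ∑ k : FreqMomentum L M, ∑ σ : Fin 2,
    ((K.eval (latticeMomentum L k.2) / (β * (L : ℝ) ^ 2) : ℝ) : ℂ) • (psiPlus k σ * psiMinus k σ)

/-- The **interaction in the frame `K`**: `V_K = V + 𝒩_K`, Hubbard vertex plus quadratic counterterm
(FST 1996 §2: the flow starts from `𝒢₀ = λV + 𝒦`; BGM 2003 (2.9): `e^{-𝒱(ψ)-𝒩(ψ)}`).  With the free part
of band `e_K` this is the SAME Hamiltonian `dWaveSourceTorus L U μ h` (`ξ = e_K + K`,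
`nambuXi_eq_nambuXiCT_add`). [cite: FeldmanSalmhoferTrubowitz1996, §2 (𝒢₀ = λV + 𝒦)] -/
def hubbardInteractionCT (β U : ℝ) (K : TrigPolyC4v) : HubbardGrassmann L M :=
  hubbardInteraction L M β U + counterQuadratic L M β K

/-- The counterterm vertex has no constant part. [folklore] -/
theorem constPart_counterQuadratic (β : ℝ) (K : TrigPolyC4v) : constPart ℂ (counterQuadratic L M β K) = 0 := by
  simp [counterQuadratic, map_sum, psiPlus, psiMinus]

/-- The bare frame has no counterterm: `𝒩_0 = 0`. [folklore] -/
@[simp] theorem counterQuadratic_zero (β : ℝ) : counterQuadratic L M β 0 = 0 := by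
  simp [counterQuadratic]

/-- `V_K` has no constant part. [folklore] -/
theorem constPart_hubbardInteractionCT (β U : ℝ) (K : TrigPolyC4v) :
    constPart ℂ (hubbardInteractionCT L M β U K) = 0 := by
  rw [hubbardInteractionCT, map_add, constPart_hubbardInteraction, constPart_counterQuadratic, add_zero]

/-- `V_K` is nilpotent. [folklore] -/
theorem isNilpotent_hubbardInteractionCT (β U : ℝ) (K : TrigPolyC4v) :
    IsNilpotent (hubbardInteractionCT L M β U K) :=
  isNilpotent_of_constPart_eq_zero ℂ (constPart_hubbardInteractionCT L M β U K)

/-- Bare frame: `V_0 = V`, the tree's `hubbardInteraction`. [folklore] -/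
@[simp] theorem hubbardInteractionCT_zero_frame (β U : ℝ) :
    hubbardInteractionCT L M β U 0 = hubbardInteraction L M β U := by
  rw [hubbardInteractionCT, counterQuadratic_zero, add_zero]

end Interaction

/-! ### §5 The effective action at scale `Λ` in the frame `K` -/

section EffectiveAction

variable (L M : ℕ) [NeZero L]

/-- **The Wilsonian effective action of the seeded Hubbard torus at infrared scale `Λ` in the
counterterm frame `K`**: `𝒢^K_Λ = -log ( (Z^K_Λ)⁻¹ ∫ dμ_{C^K_{>Λ}}(φ) e^{-V_K(ψ + φ)} )` — the fields with
`|iω - e_K| ≳ Λ` integrated out with the free covariance of the RENORMALISED band `e_K = ε_L - μ - K`, the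
counterterm `Σ K(βL²)⁻¹ψ̂⁺ψ̂⁻` riding in the interaction (FST 1996 §2; BGM 2003 §1.2; Salmhofer 1998,
§7: "a Wick ordering covariance which already contains part of the self-energy"), normalised to zero
constant part; same model as `hubbardEffectiveAction` (`K = 0`: `hubbardEffectiveActionCT_zero_frame`),
scales decomposed around `{e_K = 0}` instead of `{ξ = 0}`.  Parameters: `L`, Matsubara cutoff `M`, `β`,
`U`, `μ`, seed `h`, frame `K`, scale `Λ`. [cite: FeldmanSalmhoferTrubowitz1996, §2 (Flow of Effective Actions)] -/
def hubbardEffectiveActionCT (β U μ h : ℝ) (K : TrigPolyC4v) (Λ : ℝ) : HubbardGrassmann L M :=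
  effAction ℂ (hubbardCovAboveCT L M β μ h K Λ) (hubbardInteractionCT L M β U K)

/-- The **normalised partition function at scale `Λ` in the frame `K`**, `Z^K_Λ = ∫ dμ_{C^K_{>Λ}} e^{-V_K}`.
[folklore] -/
def hubbardEffPartitionFnCT (β U μ h : ℝ) (K : TrigPolyC4v) (Λ : ℝ) : ℂ :=
  effPartitionFn ℂ (hubbardCovAboveCT L M β μ h K Λ) (hubbardInteractionCT L M β U K)

variable (β U μ h : ℝ) (K : TrigPolyC4v)

/-- Unfolding `hubbardEffectiveActionCT`. [folklore] -/
theorem hubbardEffectiveActionCT_def (Λ : ℝ) : hubbardEffectiveActionCT L M β U μ h K Λ =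
    effAction ℂ (hubbardCovAboveCT L M β μ h K Λ) (hubbardInteractionCT L M β U K) := rfl

/-- **Bare frame**: `𝒢^0_Λ = 𝒢_Λ`, the tree's `hubbardEffectiveAction` (requirement (a) of the request).
[folklore] -/
theorem hubbardEffectiveActionCT_zero_frame (Λ : ℝ) :
    hubbardEffectiveActionCT L M β U μ h 0 Λ = hubbardEffectiveAction L M β U μ h Λ := by
  rw [hubbardEffectiveActionCT, hubbardCovAboveCT_zero_frame, hubbardInteractionCT_zero_frame,
    hubbardEffectiveAction]

/-- Bare frame: `Z^0_Λ = Z_Λ`, the tree's `hubbardEffPartitionFn`. [folklore] -/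
theorem hubbardEffPartitionFnCT_zero_frame (Λ : ℝ) :
    hubbardEffPartitionFnCT L M β U μ h 0 Λ = hubbardEffPartitionFn L M β U μ h Λ := by
  rw [hubbardEffPartitionFnCT, hubbardCovAboveCT_zero_frame, hubbardInteractionCT_zero_frame,
    hubbardEffPartitionFn]

/-- The CT effective action has no constant part (when `Z^K_Λ ≠ 0`). [folklore] -/
theorem constPart_hubbardEffectiveActionCT {Λ : ℝ} (hZ : hubbardEffPartitionFnCT L M β U μ h K Λ ≠ 0) :
    constPart ℂ (hubbardEffectiveActionCT L M β U μ h K Λ) = 0 :=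
  constPart_effAction ℂ _ _ (isUnit_iff_ne_zero.2 hZ)

/-- **The semigroup property in the scale**, in the frame `K` (Salmhofer 1999, (2.106)): `𝒢^K_Λ` is
obtained from `𝒢^K_{Λ'}` by integrating out the slice `C^K_{(Λ,Λ']}`, provided `Z^K_{Λ'} ≠ 0`.
[cite: Salmhofer1999, §2.5.1 (2.106)] -/
theorem hubbardEffectiveActionCT_semigroup {Λ' : ℝ} (Λ : ℝ) (hZ : hubbardEffPartitionFnCT L M β U μ h K Λ' ≠ 0) :
    hubbardEffectiveActionCT L M β U μ h K Λ =
      effAction ℂ (hubbardCovSliceCT L M β μ h K Λ Λ') (hubbardEffectiveActionCT L M β U μ h K Λ') := by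
  rw [hubbardEffectiveActionCT, hubbardCovAboveCT_eq_slice_add L M β μ h K Λ Λ', hubbardEffectiveActionCT]
  exact effAction_add ℂ _ _ _ (isUnit_iff_ne_zero.2 hZ)

/-- … and for the Boltzmann factors, unconditionally:
`μ_{C^K_{>Λ}} ⋆ e^{-V_K} = μ_{C^K_{(Λ,Λ']}} ⋆ (μ_{C^K_{>Λ'}} ⋆ e^{-V_K})` (Salmhofer 1999, (2.105)).
[cite: Salmhofer1999, §2.5.1 (2.105)] -/
theorem hubbardEffBoltzmannCT_semigroup (Λ Λ' : ℝ) :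
    effBoltzmann ℂ (hubbardCovAboveCT L M β μ h K Λ) (hubbardInteractionCT L M β U K) =
      gaussConv ℂ (hubbardCovSliceCT L M β μ h K Λ Λ')
        (effBoltzmann ℂ (hubbardCovAboveCT L M β μ h K Λ') (hubbardInteractionCT L M β U K)) := by
  rw [hubbardCovAboveCT_eq_slice_add L M β μ h K Λ Λ', effBoltzmann_add]

/-- **Initial condition**: if no field is above scale `Λ` then `𝒢^K_Λ = V_K` — the flow starts from the
Hubbard vertex PLUS the counterterm (FST 1996 §2: `𝒢₀ = λV + 𝒦`). [folklore] -/
theorem hubbardEffectiveActionCT_eq_interaction {Λ : ℝ} (hw : ∀ k, hubbardCutoffWeightCT L M β μ K Λ k = 0) :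
    hubbardEffectiveActionCT L M β U μ h K Λ = hubbardInteractionCT L M β U K := by
  rw [hubbardEffectiveActionCT, hubbardCovAboveCT_eq_zero_of_weight L M hw,
    effAction_zero_cov ℂ _ (constPart_hubbardInteractionCT L M β U K)]

/-- For `0 < Λ ≤ π/β` everything is integrated: `𝒢^K_Λ` is the effective action of the full CT covariance
with the interaction `V_K`. [folklore] -/
theorem hubbardEffectiveActionCT_eq_of_le {Λ : ℝ} (hβ : 0 < β) (hΛ : 0 < Λ) (hle : Λ ≤ Real.pi / β) :
    hubbardEffectiveActionCT L M β U μ h K Λ =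
      effAction ℂ (hubbardCovarianceCT L M β μ h K) (hubbardInteractionCT L M β U K) := by
  rw [hubbardEffectiveActionCT, hubbardCovAboveCT_eq_of_le L M hβ hΛ hle]

end EffectiveAction

end Literature.MathematicalPhysics.QuantumLattice
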